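import Summits.BirchSwinnertonDyer.Rank1Residual.GaloisImage.SelmerClassInertia
import Summits.BirchSwinnertonDyer.Rank1Residual.GaloisImage.ContinuousH1CoefficientTransport
import HarnessLib

/-!
# Converse of `SelmerClassInertia`: a crossed homomorphism vanishing on the inertia group at `v`
# has its localisation in `H¹_ur(K_v, M)` (cell `b2b-bsdres`, team n1011, seat p11 GEN 8, row T-DER,
# THEOREM B — the `ℤ`-currency reading; file F9)

HONEST FRAMING (cell `b2b-bsdres`, run/shared/lean/b2b/bsd-rank1-residual/, verbatim in every
file): the goal of the cell is to DELETE the COMBINATION-SHAPED residual classes of the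
Birch–Swinnerton-Dyer formula for ALL analytic-rank `≤ 1` elliptic curves over `ℚ` — "full BSD
formula for every rank `≤ 1` curve in class `C`" assembled STRICTLY from published theorems — so
that the rank-`≤ 1` remainder becomes exactly the CONSTRUCTION-SHAPED classes, which are TYPED
(missing-input `Prop`s), NOT attempted. This is not "finishing BSD". Team n1011: research route on
the CONSTRUCTION-SHAPED class X4; no claim beyond the stated classes; nothing is booked. TOOL
theorems of Galois cohomology (no definition, no named fact, no `sorry`).

## What

`GaloisImage/SelmerClassInertia.lean` (p15/p13 lineage) proves: a class whose localisation at `v`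
lies in `H¹_ur(K_v, M)` is represented by a crossed homomorphism vanishing on every `I_𝔓`, `𝔓 ∣ v`
(for `M` unramified at `v`).  This file proves the CONVERSE, with no hypothesis on `M`:
* `oneCocycleClass_mem_unramifiedSubgroup_of_apply_eq_zero` (local) — over a non-archimedean
  local field `F`, a continuous crossed homomorphism `f : Γ_F → M` with `f(I_F) = 0` has class in
  `H¹_ur(F, M) = ker (H¹(F, M) → H¹(F^{nr}, M))` (the pull-back of `f` to `Γ_{F^{nr}}` is
  identically zero, `Γ_{F^{nr}} → Γ_F` landing in `I_F`);
* `localization_mem_unramifiedSubgroup_of_apply_eq_zero` (global) — over a number field, if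
  `f : Γ_K → M` vanishes on the inertia group `I_{𝔓₀}` of the prime `𝔓₀ = adicCompletionPrime K v`
  of the completion (`= res (I_{K_v})`, `inertia_adicCompletionPrime_eq_map_absInertia`), then
  `loc_v [f] ∈ H¹_ur(K_v, M)`; `…_of_forall_primesAbove` takes the hypothesis at every `𝔓 ∣ v`;
* `localization_transport_mem_unramifiedSubgroup` (§3) — the same read through ANY coefficient
  transport `Φ : H¹_cont(Γ_K, X) →+ H¹(K, M)` "computed on cocycles" by an additive equivariant
  continuous `e : X → M` (p13's GZ-1 `CoeffTransport.exists_addMonoidHom_oneCocycleClass`, e.g.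
  `X = T′` a `ℤ_p`-linear representation and `M = E[p^n]` in `ℤ`-currency): if every representative
  of `κ ∈ H¹_cont(Γ_K, X)` vanishes on the inertia groups above `v`, then `loc_v (Φ κ) ∈ H¹_ur(K_v, M)`.
This is the last link of THEOREM B of row T-DER in the `ℤ`-linear `DiscreteGaloisModule` currency
of the Kolyvagin-system files: F7/F8 (`Derivative.apply_eq_zero_of_resSubgroup_eq_deriv[_tate]`)
give "every representative of `κ_r` vanishes on every `I_𝔓`, `𝔓 ∣ v`" for the `ℤ_p`-linear class,
p13's coefficient transport (`CoeffTransport.exists_addMonoidHom_oneCocycleClass`, computed on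
cocycles) carries that property to `galoisCohomology (W.torsionGaloisModule m) 1`, and this file
turns it into `loc_v κ_r ∈ unramifiedSubgroup` — Rubin's `κ_r ∈ H¹_u` at the good `v ∤ r p`
([Rubin2011] Thm. 4.3.10 (1), Ex. 3.1.6 (2); [MR04] Remark A.5).

References: J.-P. Serre, *Local Fields*, Ch. IV §4; J. S. Milne, *Arithmetic Duality Theorems*
(2006), Ch. I §4; K. Rubin, PCMS 18 (2011), §1.4 Prop. 1.4.13, §3.1.
-/

noncomputable section

open scoped NumberField Pointwise
open Function Field NumberField IsDedekindDomain
open Literature.NumberTheory.GaloisRepresentations Literature.NumberTheory.GaloisRepresentations.DiscreteGaloisModule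
  Literature.NumberTheory.GaloisRepresentations.IsNonarchimedeanLocalField

universe u

namespace Summit.BirchSwinnertonDyer.Rank1Residual.GaloisImage.SelmerFinite

/-! ## §1. Local -/

section Local

variable {F : Type u} [Field F] [ValuativeRel F] [TopologicalSpace F] [IsNonarchimedeanLocalField F]
variable {M : Type u} [AddCommGroup M] [TopologicalSpace M] [DiscreteTopology M]

/-- **A crossed homomorphism vanishing on the inertia group has unramified class**: if
`f : Γ_F → M` vanishes on `I_F`, then `[f] ∈ H¹_ur(F, M) = ker (H¹(F, M) → H¹(F^{nr}, M))` — the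
pull-back of `f` along `Γ_{F^{nr}} → Γ_F`, whose image is contained in `I_F = Gal(F̄/F^{nr})`, is
the zero cocycle.  No hypothesis on `M`. [folklore] -/
theorem oneCocycleClass_mem_unramifiedSubgroup_of_apply_eq_zero (τ : DiscreteGaloisModule F M)
    (f : contOneCocycles τ.toTopRep) (hf : ∀ t ∈ absInertia F, f.1 t = 0) :
    oneCocycleClass τ.toTopRep f ∈ unramifiedSubgroup τ 1 := by
  haveI : Normal F (maxUnramified F) := maxUnramified_normal
  set E := maxUnramified F with hE
  refine (mem_unramifiedSubgroup_iff τ 1 _).mpr ?_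
  rw [show galoisCohomology.res τ E 1 (oneCocycleClass τ.toTopRep f) =
      oneCocycleClass (DiscreteGaloisModule.toTopRep (GaloisRep.restrictField E τ))
        (contOneCocycles.pullback (absGaloisRestrict F E) (X := τ.toTopRep)
          (Y := DiscreteGaloisModule.toTopRep (GaloisRep.restrictField E τ))
          (TopRep.ofHom ⟨ContinuousLinearMap.id ℤ M, fun _ => rfl⟩) f) from
    map_oneCocycleClass _ _ _ f]
  have hfix : ∀ t' : absoluteGaloisGroup E, absGaloisRestrict F E t' ∈ absInertia F := fun t' =>
    mem_absInertia_iff_forall_mem_maxUnramified.mpr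
      ((mem_absGaloisFixingSubgroup_iff E _).mp (absGaloisRestrict_mem_absGaloisFixingSubgroup F E t'))
  have hzero : contOneCocycles.pullback (absGaloisRestrict F E) (X := τ.toTopRep)
      (Y := DiscreteGaloisModule.toTopRep (GaloisRep.restrictField E τ))
      (TopRep.ofHom ⟨ContinuousLinearMap.id ℤ M, fun _ => rfl⟩) f = 0 := by
    refine Subtype.ext (ContinuousMap.ext fun t' => ?_)
    rw [contOneCocycles.pullback_apply]
    change f.1 (absGaloisRestrict F E t') = 0
    exact hf _ (hfix t')
  rw [hzero]
  exact oneCocycleClass_zero _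

end Local

/-! ## §2. Global -/

section Global

variable {K : Type u} [Field K] [NumberField K]
variable {M : Type u} [AddCommGroup M] [TopologicalSpace M] [DiscreteTopology M]
variable (ρ : DiscreteGaloisModule K M)

/-- **A crossed homomorphism vanishing on the inertia group of the prime of the completion has
unramified localisation**: if `f : Γ_K → M` vanishes on `I_{𝔓₀}`, `𝔓₀ = adicCompletionPrime K v`
(`I_{𝔓₀} = res (I_{K_v})`, `inertia_adicCompletionPrime_eq_map_absInertia`), then
`loc_v [f] ∈ H¹_ur(K_v, M)`.  Converse of `apply_eq_zero_of_mem_inertia_of_localization_mem`; no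
unramifiedness of `M` needed in this direction. [folklore] -/
theorem localization_mem_unramifiedSubgroup_of_apply_eq_zero (v : HeightOneSpectrum (𝓞 K))
    (f : contOneCocycles ρ.toTopRep)
    (hf : ∀ σ ∈ (adicCompletionPrime K v).inertia (absoluteGaloisGroup K), f.1 σ = 0) :
    galoisCohomology.localization ρ (Sum.inr v) 1 (oneCocycleClass ρ.toTopRep f) ∈
      unramifiedSubgroup (GaloisRep.toLocal v ρ) 1 := by
  set L := v.adicCompletion K with hL
  rw [PrimeChoice.localization_inr_oneCocycleClass]
  refine oneCocycleClass_mem_unramifiedSubgroup_of_apply_eq_zero (GaloisRep.toLocal v ρ) _ ?_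
  intro t ht
  rw [contOneCocycles.pullback_apply]
  change f.1 (absGaloisRestrict K L t) = 0
  refine hf _ ?_
  rw [inertia_adicCompletionPrime_eq_map_absInertia]
  exact Subgroup.mem_map_of_mem _ ht

/-- The same with the hypothesis at every prime `𝔓 ∣ v` (the form produced by
`Derivative.apply_eq_zero_of_resSubgroup_eq_deriv`, THEOREM B-ur of row T-DER). [folklore] -/
theorem localization_mem_unramifiedSubgroup_of_forall_primesAbove (v : HeightOneSpectrum (𝓞 K))
    (f : contOneCocycles ρ.toTopRep)
    (hf : ∀ 𝔓 ∈ v.primesAbove, ∀ σ ∈ 𝔓.inertia (absoluteGaloisGroup K), f.1 σ = 0) :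
    galoisCohomology.localization ρ (Sum.inr v) 1 (oneCocycleClass ρ.toTopRep f) ∈
      unramifiedSubgroup (GaloisRep.toLocal v ρ) 1 :=
  localization_mem_unramifiedSubgroup_of_apply_eq_zero ρ v f
    (hf _ (adicCompletionPrime_mem_primesAbove K v))

/-- **Class-level form**: a class of `H¹(K, M)` ALL of whose representatives vanish on every
inertia group above `v` localises into `H¹_ur(K_v, M)`; and conversely for `M` unramified at `v`
(`apply_eq_zero_of_mem_inertia_of_localization_mem`), so for unramified `M` the two are
equivalent. [folklore] -/
theorem localization_mem_unramifiedSubgroup_iff_forall_apply_eq_zero {v : HeightOneSpectrum (𝓞 K)}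
    (hunr : GaloisRep.IsUnramifiedAt v ρ) (c : galoisCohomology ρ 1) :
    galoisCohomology.localization ρ (Sum.inr v) 1 c ∈ unramifiedSubgroup (GaloisRep.toLocal v ρ) 1 ↔
      ∀ f : contOneCocycles ρ.toTopRep, oneCocycleClass ρ.toTopRep f = c →
        ∀ 𝔓 ∈ v.primesAbove, ∀ σ ∈ 𝔓.inertia (absoluteGaloisGroup K), f.1 σ = 0 := by
  constructor
  · intro h f hf
    rw [← hf] at h
    exact apply_eq_zero_of_mem_inertia_of_localization_mem ρ hunr f h
  · intro h
    obtain ⟨f, rfl⟩ := oneCocycleClass_surjective _ c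
    exact localization_mem_unramifiedSubgroup_of_forall_primesAbove ρ v f (h f rfl)

end Global


/-! ## §3. Through a coefficient transport computed on cocycles (p13's GZ-1) -/

section Transport

variable {K : Type u} [Field K] [NumberField K]
variable {R : Type*} [Ring R] [TopologicalSpace R]
variable {M : Type u} [AddCommGroup M] [TopologicalSpace M] [DiscreteTopology M]
variable (X : TopRep.{u} R (absoluteGaloisGroup K)) (ρ : DiscreteGaloisModule K M)

/-- **Unramified localisation through a coefficient transport.**  Let `e : X → M` be additive,
continuous and `Γ_K`-equivariant from a topological representation `X` (any coefficient ring) to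
the discrete module `M`, and `Φ : H¹_cont(Γ_K, X) →+ H¹(K, M)` an additive map computed on cocycles
by `e` (`CoeffTransport.exists_addMonoidHom_oneCocycleClass`).  If every representative of
`κ ∈ H¹_cont(Γ_K, X)` vanishes on every inertia group above `v` (the output of THEOREM B-ur,
`Derivative.apply_eq_zero_of_resSubgroup_eq_deriv`), then `loc_v (Φ κ) ∈ H¹_ur(K_v, M)`.
[folklore] -/
theorem localization_transport_mem_unramifiedSubgroup (e : X →+ M) (hec : Continuous e)
    (he : ∀ (g : absoluteGaloisGroup K) (x : X), e (X.ρ g x) = ρ.toTopRep.ρ g (e x))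
    (Φ : continuousCohomology 1 X →+ galoisCohomology ρ 1)
    (hΦ : ∀ (φ : contOneCocycles X) (ψ : contOneCocycles ρ.toTopRep), (∀ g, ψ.1 g = e (φ.1 g)) →
      Φ (oneCocycleClass X φ) = oneCocycleClass ρ.toTopRep ψ)
    (v : HeightOneSpectrum (𝓞 K)) (κ : continuousCohomology 1 X)
    (hκ : ∀ φ : contOneCocycles X, oneCocycleClass X φ = κ →
      ∀ 𝔓 ∈ v.primesAbove, ∀ σ ∈ 𝔓.inertia (absoluteGaloisGroup K), φ.1 σ = 0) :
    galoisCohomology.localization ρ (Sum.inr v) 1 (Φ κ) ∈ unramifiedSubgroup (GaloisRep.toLocal v ρ) 1 := by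
  obtain ⟨φ, rfl⟩ := oneCocycleClass_surjective X κ
  let ψ : contOneCocycles ρ.toTopRep := ⟨_, CoeffTransport.comp_mem_contOneCocycles X ρ.toTopRep e hec he φ⟩
  have hψ : ∀ g, ψ.1 g = e (φ.1 g) := fun _ => rfl
  rw [hΦ φ ψ hψ]
  refine localization_mem_unramifiedSubgroup_of_forall_primesAbove ρ v ψ fun 𝔓 h𝔓 σ hσ => ?_
  rw [hψ, hκ φ rfl 𝔓 h𝔓 σ hσ, map_zero]

end Transport

end Summit.BirchSwinnertonDyer.Rank1Residual.GaloisImage.SelmerFinite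

end
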